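import Literature.MathematicalPhysics.QuantumLattice.PairFieldPairedVectors
import Literature.MathematicalPhysics.QuantumLattice.FreeFermionSectorEnergyDeviation
import HarnessLib

/-!
# The signed momentum pair condensate: a kinematic floor for the `d`-wave order functional

Solo programme `solo-HubbardSuperconductivity-blind`, structural Theorem 22 (part 1: the abstract
condensate; part 2, `SoloBlindDWaveModeCount`, counts the `d`-wave modes and evaluates the floor at
the summit's filling). The summit's order functional is `re ⟨φ, ΔᴴΔ φ⟩`, `Δ = pairField
dWaveFormFactor L = √2 Δ_d = -Σ_k w_k b_k` (`pairField_eq_neg_sum_pairFieldMode_smul_pairMode`,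
`w_k = 2√2 (cos p₁ - cos p₂)`, `b_k = c_{-k↓} c_{k↑}`). How large CAN it be on the sector
`(N, S^z) = (2n, 0)`? The answer `≍ n (L² - n)` (the BCS / Yang scale, `≍ L⁴` at fixed filling) is
realised here CONSTRUCTIVELY by the number-projected, SIGNED pair condensate over a set `A` of
`m` momenta on which `|w_k| ≥ γ`:

  `Ψ_{A,n} = Σ_{S ⊆ A, |S| = n} σ_S Φ_S`,  `Φ_S = Π_{k∈S} b†_k |∅⟩`,  `σ_S = Π_{k∈S} sign w_k`.

* `star_paired_dotProduct_paired` — the paired vectors are ORTHONORMAL, `⟨Φ_T, Φ_S⟩ = [S = T]`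
  (a momentum `q ∈ S ∖ T` is detected by the Hermitian occupation `n_{q↑}`);
* `pairMode_conjTranspose_mulVec_paired` — `b†_k Φ_T = [k ∉ T] Φ_{T ∪ {k}}` (hard core), whence
  `conjTranspose_pairField_mulVec_paired`: `Δᴴ Φ_T = -Σ_{k ∉ T} w_k Φ_{T ∪ {k}}`;
* `star_paired_dotProduct_condensate`, `star_condensate_dotProduct_self` — `⟨Φ_T, Ψ_{A,i}⟩ =
  [T ⊆ A, |T| = i] σ_T` and `‖Ψ_{A,i}‖² = C(m, i)`;
* `star_paired_dotProduct_pairField_mulVec_condensate` — the signs make every channel add up: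
  `⟨Φ_T, Δ Ψ_{A,j+1}⟩ = -σ_T Σ_{k ∈ A∖T} |w_k|` for `T ⊆ A`, `|T| = j`, so that
  `⟨Ψ_{A,j}, Δ Ψ_{A,j+1}⟩ = -Σ_{T} Σ_{k∈A∖T} |w_k| ≤ -C(m,j) (m-j) γ`
  (`star_condensate_dotProduct_pairField_mulVec_condensate`);
* `condensate_order_ge` — by Cauchy–Schwarz against `Ψ_{A,j}` and `C(m,j)(m-j) = C(m,j+1)(j+1)`:
  **`re ⟨Ψ, ΔᴴΔ Ψ⟩ ≥ γ² (j+1)(m-j) ‖Ψ‖²` for `Ψ = Ψ_{A,j+1}`**, a vector of the sector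
  `(2(j+1), S^z = 0)` (`condensate_mem_szSector`), nonzero iff `j+1 ≤ m`;
* `exists_szSector_order_ge` — packaged: for `1 ≤ n ≤ m` the sector `(2n, 0)` contains a nonzero
  vector of order `≥ γ² n (m-n+1) ‖·‖²`.

Role in the programme (report §9): this is the KINEMATIC side of the summit — the order functional's
sector maximum `Λ_L = max spec (ΔᴴΔ | K_L)` is `≥ c₀ L⁴` with an explicit `c₀(δ)` (part 2), so the
summit asks the repulsive Hubbard ground states to retain a FIXED FRACTION `c/c₀` of the largest
order any state of the sector can carry; and it is the input of Theorem 23 (`SoloBlindCrutchAxis`: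
the Hubbard model crutched by `-g L⁻² ΔᴴΔ` has `d`-wave long-range order in EVERY ground state once
`g ≥ g₀(U,δ)`, a proved instance of the summit's exact conclusion for a deformed Hamiltonian).

References: J. Bardeen, L. N. Cooper, J. R. Schrieffer, Phys. Rev. 108 (1957) 1175, §II (the
number-projected pair condensate); C. N. Yang, Rev. Mod. Phys. 34 (1962) 694, §§4–5 (the largest
eigenvalue `≍ n(M-n+1)` of a fermion pair reduced density matrix); A. J. Coleman, J. Math. Phys. 6
(1965) 1425, §§3–5 (extreme geminals / AGP). The signed projected condensate and the one-line
Cauchy–Schwarz evaluation are elementary. [this work]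
-/

noncomputable section

namespace Summit.HubbardSuperconductivity.HubbardSuperconductivity.Theorems.PairCondensate

open Matrix Finset Literature.Probability.LatticeModels
  Literature.MathematicalPhysics.QuantumLattice
open scoped ComplexOrder ComplexConjugate

variable {L : ℕ} [NeZero L]

omit [NeZero L] in
/-- `⟨x, A y⟩ = ⟨Aᴴ x, y⟩` for the pairing `star · ⬝ᵥ ·`. [folklore] -/
private theorem star_dotProduct_mulVec_eq {ι : Type*} [Fintype ι] (A : Matrix ι ι ℂ)
    (x y : ι → ℂ) : star x ⬝ᵥ (A *ᵥ y) = star (Aᴴ *ᵥ x) ⬝ᵥ y := by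
  rw [star_mulVec, conjTranspose_conjTranspose, dotProduct_mulVec]

/-- The paired vector `Φ_S = Π_{k∈S} b†_k |∅⟩` of a finite momentum set (literal term). -/
local notation "Φ[" S "]" =>
  (List.prod (List.map (fun k : TorusSite 2 _ => (pairMode k)ᴴ) (Finset.toList S)) *ᵥ
    (vacuum : Fock (Orb (FermionTorus 2 _))))

/-- The `d`-wave profile `w_k = pairFieldMode dWaveFormFactor L k = 2√2 (cos p₁ - cos p₂)`. -/
local notation "W[" k "]" => (pairFieldMode dWaveFormFactor _ k)

/-- The sign `s_k ∈ {±1}` of `w_k` (as a real number). -/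
local notation "sg[" k "]" =>
  (ite ((0 : ℝ) ≤ pairFieldMode dWaveFormFactor _ k) (1 : ℝ) (-1))

/-- `σ_S = Π_{k∈S} s_k`. -/
local notation "σ[" S "]" => (∏ k ∈ S, sg[k])

/-- The signed number-projected condensate `Ψ_{A,i} = Σ_{S ⊆ A, |S| = i} σ_S Φ_S`. -/
local notation "Ψ[" A " ; " i "]" =>
  (∑ S ∈ Finset.powersetCard i A, (((σ[S] : ℝ)) : ℂ) • Φ[S])

/-! ### Orthonormality and the raising rule -/

/-- **Orthonormality of the paired vectors**: `⟨Φ_T, Φ_S⟩ = [S = T]` for finite momentum sets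
`S, T` (a momentum `q` in one set but not the other is seen by the Hermitian occupation `n_{q↑}`,
which fixes one vector and kills the other). BCS 1957 §II. [folklore] -/
theorem star_paired_dotProduct_paired (S T : Finset (TorusSite 2 L)) :
    star Φ[T] ⬝ᵥ Φ[S] = if S = T then 1 else 0 := by
  classical
  have key : ∀ {S T : Finset (TorusSite 2 L)} {q : TorusSite 2 L}, q ∈ S → q ∉ T →
      star Φ[T] ⬝ᵥ Φ[S] = 0 := by
    intro S T q hqS hqT
    have h1 : momentumNumber q 0 *ᵥ Φ[S] = Φ[S] :=
      momentumNumber_up_pairedState_of_mem (by rwa [Finset.mem_toList])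
    have h2 : momentumNumber q 0 *ᵥ Φ[T] = 0 :=
      momentumNumber_up_pairedState_of_not_mem (by rwa [Finset.mem_toList])
    calc star Φ[T] ⬝ᵥ Φ[S] = star Φ[T] ⬝ᵥ (momentumNumber q 0 *ᵥ Φ[S]) := by rw [h1]
      _ = star ((momentumNumber q 0)ᴴ *ᵥ Φ[T]) ⬝ᵥ Φ[S] := star_dotProduct_mulVec_eq _ _ _
      _ = 0 := by rw [momentumNumber_conjTranspose, h2, star_zero, zero_dotProduct]
  by_cases hST : S = T
  · subst hST
    rw [if_pos rfl]
    exact star_pairedState_dotProduct_self (Finset.nodup_toList S)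
  rw [if_neg hST]
  by_cases hsub : S ⊆ T
  · obtain ⟨q, hqT, hqS⟩ :=
      Finset.not_subset.1 (fun h => hST (Finset.Subset.antisymm hsub h))
    rw [star_dotProduct, key hqT hqS, star_zero]
  · obtain ⟨q, hqS, hqT⟩ := Finset.not_subset.1 hsub
    exact key hqS hqT

/-- **Raising rule**: `b†_k Φ_T = Φ_{T ∪ {k}}` for `k ∉ T` and `b†_k Φ_T = 0` for `k ∈ T`
(`(b†_k)² = 0`, `pairMode_mul_self`). von Delft–Ralph 2001 §4.2.3. [folklore] -/
theorem pairMode_conjTranspose_mulVec_paired (T : Finset (TorusSite 2 L)) (k : TorusSite 2 L) :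
    (pairMode k)ᴴ *ᵥ Φ[T] = if k ∈ T then 0 else Φ[insert k T] := by
  classical
  by_cases hk : k ∈ T
  · rw [if_pos hk, paired_toList_eq_cons hk, mulVec_mulVec, ← conjTranspose_mul,
      pairMode_mul_self, conjTranspose_zero, zero_mulVec]
  · rw [if_neg hk, paired_toList_eq_cons (Finset.mem_insert_self k T), Finset.erase_insert hk]

/-- **The adjoint pair field raises a paired vector into every free mode**:
`Δᴴ Φ_T = -Σ_{k ∉ T} w_k Φ_{T ∪ {k}}` (`Δᴴ = -Σ_k w_k b†_k`, `w` real). [folklore] -/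
theorem conjTranspose_pairField_mulVec_paired (T : Finset (TorusSite 2 L)) :
    (pairField dWaveFormFactor L)ᴴ *ᵥ Φ[T] =
      -∑ k ∈ Finset.univ \ T, ((W[k] : ℝ) : ℂ) • Φ[insert k T] := by
  classical
  rw [pairField_eq_neg_sum_pairFieldMode_smul_pairMode, conjTranspose_neg, conjTranspose_sum,
    neg_mulVec, sum_mulVec]
  congr 1
  have h1 : ∀ k : TorusSite 2 L, ((((W[k] : ℝ) : ℂ) • pairMode k)ᴴ) *ᵥ Φ[T] =
      ((W[k] : ℝ) : ℂ) • (if k ∈ T then (0 : Fock (Orb (FermionTorus 2 L))) else Φ[insert k T]) := by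
    intro k
    rw [conjTranspose_smul, smul_mulVec, pairMode_conjTranspose_mulVec_paired, Complex.star_def,
      Complex.conj_ofReal]
  rw [Finset.sum_congr rfl fun k _ => h1 k,
    ← Finset.sum_subset (Finset.subset_univ (Finset.univ \ T))]
  · refine Finset.sum_congr rfl fun k hk => ?_
    rw [if_neg (Finset.mem_sdiff.1 hk).2]
  · intro k _ hk
    have hkT : k ∈ T := by
      by_contra h
      exact hk (Finset.mem_sdiff.2 ⟨Finset.mem_univ k, h⟩)
    rw [if_pos hkT, smul_zero]

/-! ### Signs -/

omit [NeZero L] in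
/-- `s_k² = 1`. [folklore] -/
theorem sg_mul_self [NeZero L] (k : TorusSite 2 L) : sg[k] * sg[k] = 1 := by
  split_ifs <;> norm_num

omit [NeZero L] in
/-- `s_k w_k = |w_k|`. [folklore] -/
theorem sg_mul_pairFieldMode [NeZero L] (k : TorusSite 2 L) : sg[k] * W[k] = |W[k]| := by
  split_ifs with h
  · rw [one_mul, abs_of_nonneg h]
  · rw [neg_one_mul, abs_of_neg (lt_of_not_ge h)]

omit [NeZero L] in
/-- `σ_S² = 1`. [folklore] -/
theorem sigma_mul_self [NeZero L] (S : Finset (TorusSite 2 L)) : σ[S] * σ[S] = 1 := by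
  rw [← Finset.prod_mul_distrib]
  exact Finset.prod_eq_one fun k _ => sg_mul_self k

/-! ### The signed condensate -/

/-- `⟨Φ_T, Ψ_{A,i}⟩ = [T ⊆ A, |T| = i] σ_T`. [this work] -/
theorem star_paired_dotProduct_condensate (A T : Finset (TorusSite 2 L)) (i : ℕ) :
    star Φ[T] ⬝ᵥ Ψ[A ; i] = if T ∈ A.powersetCard i then (((σ[T] : ℝ)) : ℂ) else 0 := by
  classical
  rw [dotProduct_sum]
  have h : ∀ S ∈ A.powersetCard i, star Φ[T] ⬝ᵥ ((((σ[S] : ℝ)) : ℂ) • Φ[S]) =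
      if S = T then (((σ[S] : ℝ)) : ℂ) else 0 := by
    intro S _
    rw [dotProduct_smul, star_paired_dotProduct_paired, smul_eq_mul, mul_ite, mul_one, mul_zero]
  rw [Finset.sum_congr rfl h, Finset.sum_ite_eq']

/-- **`‖Ψ_{A,i}‖² = C(|A|, i)`** (orthonormality; `σ_S² = 1`). [this work] -/
theorem star_condensate_dotProduct_self (A : Finset (TorusSite 2 L)) (i : ℕ) :
    star Ψ[A ; i] ⬝ᵥ Ψ[A ; i] = ((A.powersetCard i).card : ℂ) := by
  classical
  rw [star_sum, sum_dotProduct]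
  have h : ∀ S ∈ A.powersetCard i, star ((((σ[S] : ℝ)) : ℂ) • Φ[S]) ⬝ᵥ Ψ[A ; i] = 1 := by
    intro S hS
    rw [star_smul, smul_dotProduct, star_paired_dotProduct_condensate, if_pos hS, Complex.star_def,
      Complex.conj_ofReal, smul_eq_mul, ← Complex.ofReal_mul, sigma_mul_self, Complex.ofReal_one]
  rw [Finset.sum_congr rfl h, Finset.sum_const, nsmul_eq_mul, mul_one]

/-- `Ψ_{A,i}` lies in the joint sector `(2i, S^z = 0)`. [this work] -/
theorem condensate_mem_szSector (A : Finset (TorusSite 2 L)) (i : ℕ) :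
    Ψ[A ; i] ∈ szSector (Λ := FermionTorus 2 L) (2 * i) 0 := by
  classical
  refine Submodule.sum_mem _ fun S hS => Submodule.smul_mem _ _ ?_
  have h := pairedState_mem_szSector S.toList
  rwa [Finset.length_toList, (Finset.mem_powersetCard.1 hS).2] at h

/-- `Ψ_{A,i} ≠ 0` for `i ≤ |A|`. [this work] -/
theorem condensate_ne_zero (A : Finset (TorusSite 2 L)) {i : ℕ} (hi : i ≤ A.card) :
    Ψ[A ; i] ≠ 0 := by
  classical
  intro h0
  have h := star_condensate_dotProduct_self A i
  rw [h0, star_zero, zero_dotProduct, Finset.card_powersetCard] at h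
  have hpos : 0 < A.card.choose i := Nat.choose_pos hi
  have : ((A.card.choose i : ℕ) : ℂ) = 0 := h.symm
  exact hpos.ne' (by exact_mod_cast this)

/-- **The signs make every channel add up**: for `T ⊆ A` with `|T| = j`,
`⟨Φ_T, Δ Ψ_{A,j+1}⟩ = -σ_T Σ_{k ∈ A∖T} |w_k|` (move `Δ` to the left as `Δᴴ = -Σ_k w_k b†_k`,
raise `Φ_T` into each free mode `k`, and read off `⟨Φ_{T∪{k}}, Ψ_{A,j+1}⟩ = [k ∈ A] σ_T s_k` with
`s_k w_k = |w_k|`). [this work] -/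
theorem star_paired_dotProduct_pairField_mulVec_condensate {A T : Finset (TorusSite 2 L)}
    (hTA : T ⊆ A) {j : ℕ} (hTj : T.card = j) :
    star Φ[T] ⬝ᵥ (pairField dWaveFormFactor L *ᵥ Ψ[A ; j + 1]) =
      -((((σ[T] * ∑ k ∈ A \ T, |W[k]| : ℝ)) : ℂ)) := by
  classical
  have hadj : star Φ[T] ⬝ᵥ (pairField dWaveFormFactor L *ᵥ Ψ[A ; j + 1]) =
      star ((pairField dWaveFormFactor L)ᴴ *ᵥ Φ[T]) ⬝ᵥ Ψ[A ; j + 1] :=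
    star_dotProduct_mulVec_eq _ _ _
  rw [hadj, conjTranspose_pairField_mulVec_paired, star_neg, star_sum, neg_dotProduct,
    sum_dotProduct]
  have step : ∀ k ∈ Finset.univ \ T,
      star ((((W[k] : ℝ)) : ℂ) • Φ[insert k T]) ⬝ᵥ Ψ[A ; j + 1] =
        if k ∈ A then ((((σ[T] * |W[k]| : ℝ)) : ℂ)) else 0 := by
    intro k hk
    have hkT : k ∉ T := (Finset.mem_sdiff.1 hk).2
    rw [star_smul, smul_dotProduct, star_paired_dotProduct_condensate, Complex.star_def,
      Complex.conj_ofReal, smul_eq_mul]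
    by_cases hkA : k ∈ A
    · have hmem : insert k T ∈ A.powersetCard (j + 1) := by
        rw [Finset.mem_powersetCard]
        exact ⟨Finset.insert_subset hkA hTA, by rw [Finset.card_insert_of_notMem hkT, hTj]⟩
      rw [if_pos hmem, if_pos hkA, ← Complex.ofReal_mul, Finset.prod_insert hkT]
      congr 1
      calc W[k] * (sg[k] * σ[T]) = σ[T] * (sg[k] * W[k]) := by ring
        _ = σ[T] * |W[k]| := by rw [sg_mul_pairFieldMode]
    · have hnmem : insert k T ∉ A.powersetCard (j + 1) := fun h =>
        hkA ((Finset.mem_powersetCard.1 h).1 (Finset.mem_insert_self k T))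
      rw [if_neg hnmem, if_neg hkA, mul_zero]
  rw [Finset.sum_congr rfl step, Finset.sum_ite_mem]
  have hset : (Finset.univ \ T) ∩ A = A \ T := by
    ext k
    simp only [Finset.mem_inter, Finset.mem_sdiff, Finset.mem_univ, true_and]
    tauto
  rw [hset, Complex.ofReal_mul, Complex.ofReal_sum, Finset.mul_sum]
  congr 1
  refine Finset.sum_congr rfl fun k _ => ?_
  push_cast
  ring

/-- **`⟨Ψ_{A,j}, Δ Ψ_{A,j+1}⟩ = -Σ_{T ⊆ A, |T| = j} Σ_{k ∈ A∖T} |w_k|`.** [this work] -/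
theorem star_condensate_dotProduct_pairField_mulVec_condensate (A : Finset (TorusSite 2 L))
    (j : ℕ) :
    star Ψ[A ; j] ⬝ᵥ (pairField dWaveFormFactor L *ᵥ Ψ[A ; j + 1]) =
      -((((∑ T ∈ A.powersetCard j, ∑ k ∈ A \ T, |W[k]| : ℝ)) : ℂ)) := by
  classical
  rw [star_sum, sum_dotProduct]
  have h : ∀ T ∈ A.powersetCard j,
      star ((((σ[T] : ℝ)) : ℂ) • Φ[T]) ⬝ᵥ (pairField dWaveFormFactor L *ᵥ Ψ[A ; j + 1]) =
        -((((∑ k ∈ A \ T, |W[k]| : ℝ)) : ℂ)) := by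
    intro T hT
    obtain ⟨hTA, hTj⟩ := Finset.mem_powersetCard.1 hT
    rw [star_smul, smul_dotProduct, star_paired_dotProduct_pairField_mulVec_condensate hTA hTj,
      Complex.star_def, Complex.conj_ofReal, smul_eq_mul, mul_neg, ← Complex.ofReal_mul,
      ← mul_assoc, sigma_mul_self, one_mul]
  rw [Finset.sum_congr rfl h, Finset.sum_neg_distrib, Complex.ofReal_sum]

/-- The channel sums are large: if `|w_k| ≥ γ` on `A` then
`Σ_{T ⊆ A, |T| = j} Σ_{k∈A∖T} |w_k| ≥ C(|A|,j) (|A|-j) γ`. [this work] -/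
theorem sum_sum_abs_pairFieldMode_ge (A : Finset (TorusSite 2 L)) {γ : ℝ}
    (hA : ∀ k ∈ A, γ ≤ |W[k]|) (j : ℕ) :
    ((A.card.choose j : ℕ) : ℝ) * ((A.card - j : ℕ) : ℝ) * γ ≤
      ∑ T ∈ A.powersetCard j, ∑ k ∈ A \ T, |W[k]| := by
  classical
  have h : ∀ T ∈ A.powersetCard j, ((A.card - j : ℕ) : ℝ) * γ ≤ ∑ k ∈ A \ T, |W[k]| := by
    intro T hT
    obtain ⟨hTA, hTj⟩ := Finset.mem_powersetCard.1 hT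
    have hcard : (A \ T).card = A.card - j := by rw [Finset.card_sdiff_of_subset hTA, hTj]
    calc ((A.card - j : ℕ) : ℝ) * γ = ∑ _k ∈ A \ T, γ := by
          rw [Finset.sum_const, nsmul_eq_mul, hcard]
      _ ≤ ∑ k ∈ A \ T, |W[k]| :=
          Finset.sum_le_sum fun k hk => hA k (Finset.mem_sdiff.1 hk).1
  calc ((A.card.choose j : ℕ) : ℝ) * ((A.card - j : ℕ) : ℝ) * γ
      = ∑ _T ∈ A.powersetCard j, ((A.card - j : ℕ) : ℝ) * γ := by
        rw [Finset.sum_const, Finset.card_powersetCard, nsmul_eq_mul, mul_assoc]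
    _ ≤ _ := Finset.sum_le_sum h

/-! ### The kinematic floor -/

/-- **Theorem 22 (abstract form): the order functional of the signed condensate.** If `|w_k| ≥ γ ≥ 0`
on the momentum set `A` (`|A| = m`), then `Ψ = Ψ_{A,j+1}` satisfies
`γ² (j+1) (m-j) ‖Ψ‖² ≤ re ⟨Ψ, ΔᴴΔ Ψ⟩`, `Δ = pairField dWaveFormFactor L = √2 Δ_d`
(Cauchy–Schwarz against `Ψ_{A,j}`: `|⟨Ψ_{A,j}, ΔΨ⟩| ≥ C(m,j)(m-j)γ`, `‖Ψ_{A,j}‖² = C(m,j)`,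
`‖Ψ‖² = C(m,j+1)` and `C(m,j)(m-j) = C(m,j+1)(j+1)`). At `j + 1 ≍ m ≍ L²` this is `≍ L⁴`.
[this work] -/
theorem condensate_order_ge (A : Finset (TorusSite 2 L)) {γ : ℝ} (hγ : 0 ≤ γ)
    (hA : ∀ k ∈ A, γ ≤ |W[k]|) (j : ℕ) :
    γ ^ 2 * ((j + 1 : ℕ) : ℝ) * ((A.card - j : ℕ) : ℝ) * (star Ψ[A ; j + 1] ⬝ᵥ Ψ[A ; j + 1]).re ≤
      (star Ψ[A ; j + 1] ⬝ᵥ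
        ((pairField dWaveFormFactor L)ᴴ * pairField dWaveFormFactor L) *ᵥ Ψ[A ; j + 1]).re := by
  classical
  set x := Ψ[A ; j] with hx
  set Ψ' := Ψ[A ; j + 1] with hΨ'
  set y := pairField dWaveFormFactor L *ᵥ Ψ' with hy
  set m := A.card with hm
  -- the Rayleigh quotient is `‖Δ Ψ‖²`
  have hR : (star Ψ' ⬝ᵥ ((pairField dWaveFormFactor L)ᴴ * pairField dWaveFormFactor L) *ᵥ Ψ').re =
      (star y ⬝ᵥ y).re := by
    rw [hy, ← mulVec_mulVec, star_dotProduct_mulVec_eq, conjTranspose_conjTranspose]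
  -- norms
  have hxx : (star x ⬝ᵥ x).re = ((m.choose j : ℕ) : ℝ) := by
    rw [hx, star_condensate_dotProduct_self, Finset.card_powersetCard, Complex.natCast_re]
  have hΨΨ : (star Ψ' ⬝ᵥ Ψ').re = ((m.choose (j + 1) : ℕ) : ℝ) := by
    rw [hΨ', star_condensate_dotProduct_self, Finset.card_powersetCard, Complex.natCast_re]
  -- the cross term
  set a : ℝ := ∑ T ∈ A.powersetCard j, ∑ k ∈ A \ T, |W[k]| with ha
  have hxy : ‖star x ⬝ᵥ y‖ = a := by
    rw [hx, hy, hΨ', star_condensate_dotProduct_pairField_mulVec_condensate, norm_neg,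
      Complex.norm_real, Real.norm_eq_abs, abs_of_nonneg]
    exact Finset.sum_nonneg fun T _ => Finset.sum_nonneg fun k _ => abs_nonneg _
  have ha_ge : ((m.choose j : ℕ) : ℝ) * ((m - j : ℕ) : ℝ) * γ ≤ a :=
    sum_sum_abs_pairFieldMode_ge A hA j
  have ha0 : 0 ≤ ((m.choose j : ℕ) : ℝ) * ((m - j : ℕ) : ℝ) * γ := by positivity
  -- Cauchy–Schwarz
  have hcs := norm_sq_star_dotProduct_le x y
  rw [hxy, hxx] at hcs
  have hyy0 : 0 ≤ (star y ⬝ᵥ y).re := by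
    rw [← hR, hΨ']
    exact (pairField_conjTranspose_mul_self_posSemidef dWaveFormFactor L).re_dotProduct_nonneg _
  -- Pascal: `C(m,j)(m-j) = C(m,j+1)(j+1)`
  have hpascal : ((m.choose (j + 1) : ℕ) : ℝ) * ((j + 1 : ℕ) : ℝ) =
      ((m.choose j : ℕ) : ℝ) * ((m - j : ℕ) : ℝ) := by
    exact_mod_cast Nat.choose_succ_right_eq m j
  rw [hR, hΨΨ]
  by_cases hp : m.choose j = 0
  · -- then `C(m,j+1) = 0` too and the left side vanishes
    have hj : m < j := Nat.choose_eq_zero_iff.1 hp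
    have hp' : m.choose (j + 1) = 0 := Nat.choose_eq_zero_of_lt (by omega)
    rw [hp', Nat.cast_zero, mul_zero]
    exact hyy0
  · have hppos : 0 < ((m.choose j : ℕ) : ℝ) := by exact_mod_cast Nat.pos_of_ne_zero hp
    -- `a² ≤ C(m,j) ‖y‖²` and `a ≥ C(m,j)(m-j)γ`
    have h1 : (((m.choose j : ℕ) : ℝ) * ((m - j : ℕ) : ℝ) * γ) ^ 2 ≤
        ((m.choose j : ℕ) : ℝ) * (star y ⬝ᵥ y).re :=
      (pow_le_pow_left₀ ha0 ha_ge 2).trans hcs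
    have h2 : ((m.choose j : ℕ) : ℝ) * (((m - j : ℕ) : ℝ) ^ 2 * γ ^ 2) ≤ (star y ⬝ᵥ y).re := by
      have h3 : ((m.choose j : ℕ) : ℝ) * (((m.choose j : ℕ) : ℝ) * (((m - j : ℕ) : ℝ) ^ 2 * γ ^ 2)) ≤
          ((m.choose j : ℕ) : ℝ) * (star y ⬝ᵥ y).re := by
        calc _ = (((m.choose j : ℕ) : ℝ) * ((m - j : ℕ) : ℝ) * γ) ^ 2 := by ring
          _ ≤ _ := h1
      exact le_of_mul_le_mul_left h3 hppos
    calc γ ^ 2 * ((j + 1 : ℕ) : ℝ) * ((m - j : ℕ) : ℝ) * ((m.choose (j + 1) : ℕ) : ℝ)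
        = (((m.choose (j + 1) : ℕ) : ℝ) * ((j + 1 : ℕ) : ℝ)) * ((m - j : ℕ) : ℝ) * γ ^ 2 := by ring
      _ = ((m.choose j : ℕ) : ℝ) * (((m - j : ℕ) : ℝ) ^ 2 * γ ^ 2) := by rw [hpascal]; ring
      _ ≤ (star y ⬝ᵥ y).re := h2

/-- **Theorem 22 (existence form): a sector vector of order `γ² n (m-n+1) ‖·‖²`.** If `|w_k| ≥ γ ≥ 0`
on a set `A` of `m` momenta and `1 ≤ n ≤ m`, the joint sector `(2n, S^z = 0)` of the fermionic torus
contains a nonzero vector `φ` with `γ² n (m - n + 1) · re⟨φ,φ⟩ ≤ re ⟨φ, ΔᴴΔ φ⟩`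
(`Δ = pairField dWaveFormFactor L`). Consequently the largest sector eigenvalue of the order
functional is at least `γ² n (m-n+1)`. [this work] -/
theorem exists_szSector_order_ge (A : Finset (TorusSite 2 L)) {γ : ℝ} (hγ : 0 ≤ γ)
    (hA : ∀ k ∈ A, γ ≤ |W[k]|) {n : ℕ} (hn : 1 ≤ n) (hnA : n ≤ A.card) :
    ∃ φ : Fock (Orb (FermionTorus 2 L)), φ ∈ szSector (Λ := FermionTorus 2 L) (2 * n) 0 ∧ φ ≠ 0 ∧
      γ ^ 2 * (n : ℝ) * ((A.card : ℝ) - n + 1) * (star φ ⬝ᵥ φ).re ≤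
        (star φ ⬝ᵥ
          ((pairField dWaveFormFactor L)ᴴ * pairField dWaveFormFactor L) *ᵥ φ).re := by
  classical
  obtain ⟨j, rfl⟩ : ∃ j, n = j + 1 := ⟨n - 1, by omega⟩
  refine ⟨Ψ[A ; j + 1], condensate_mem_szSector A (j + 1), condensate_ne_zero A hnA, ?_⟩
  have h := condensate_order_ge A hγ hA j
  have hcast : ((A.card - j : ℕ) : ℝ) = (A.card : ℝ) - ((j + 1 : ℕ) : ℝ) + 1 := by
    rw [Nat.cast_sub (by omega)]
    push_cast
    ring
  rw [hcast] at h
  convert h using 3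

end Summit.HubbardSuperconductivity.HubbardSuperconductivity.Theorems.PairCondensate
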